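import Summits.ResolutionOfSingularities.ResolutionOfSingularities.Theorems.PurelyInseparableDim4ResConeHeavyLineKeepStep
import Summits.ResolutionOfSingularities.ResolutionOfSingularities.Theorems.PurelyInseparableDim4PhiLineSupercriticalLabel
import Summits.ResolutionOfSingularities.ResolutionOfSingularities.Theorems.PurelyInseparableDim4ResConeHeavyLoseStep
import HarnessLib
import HarnessLib.Audit.Tags

/-!
# Purely inseparable four-folds — the HEAVY KEEP STEP, ∀ (p, d, n) (the KEEP third of «(p, d) heavy line ⟸ weights pattern», STEP LEVEL)
# (cell `res-dim4-pi`, K2(p) lane, slice C; §18 «p-generic inventory toward K2(7)» rung 1; HOLDER RULING 2026-08-29 08:19Z (3) «K_gen → p-7»)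

[OURS · counted 0 · cell `res-dim4-pi` · K2(p) lane (holder res-dim4-p-12 g4); the KEEP twin of res-dim4-p-2 g5's `heavy_lose_step`
(`…ResConeHeavyLoseStep` p709039) in the same binder style; kernel hand res-dim4-p-7 g5.]  Nothing here proves K2(p) for any `p ≥ 7`,
K2(7), `NoIsolatedTrap p p` or resolution of singularities in dimension ≥ 4 / characteristic `p` — NOT proved.  AI kernel work, weaker
than expert review.

`stub_keep` ((p,d,n) = (5,3,3), B∞), `dInf_stub_keep` ((5,4,3), D∞) and `heavyLine_stub_keep` ((p, p−1, p−2)) all compose the same Φ-line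
inputs; the shape-specific content is three inputs — the factorisation package, the KEEP pattern «chart letter `j k ≠ h`, `b k h = 0`
(the distinguished letter `h` is neither the chart letter nor translated), so `r_{k+1} h = r_k h`», and the numerals.
**`heavy_keep_step`** turns them into BINDERS: for a prime `p`, a level `d < p`, a cleaning exponent `n` with `r_k h + n = p`,
`1 ≤ n ≤ d` (CRITICAL `n = d` or SUPERCRITICAL `n < d`), a `Step0 p` edge `c k → c (k+1)` recorded in chart `j k` at `b k` with the
factorisations `F_k = x^{r_k}·G` (`ord₀ G = d`, `p < |r_k| + d < 2p`, `x^{r_k} ∣ F_k`), `(step …).F = x^{r′}·G₁`, `F_{k+1} = x^{r_{k+1}}·G₁`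
(`ord₀ G₁ = d`), constant shade, `e_G = 2` at both ends, both ends isolated, and the pattern (`j k ≠ h`, `b k h = 0`,
`r_{k+1} h = r_k h`): a RUN frame at `k` (left inverse, `u₁ = e_h`, y-rows ⟂ `resVertex (c k)`, `pts ≠ ∅`, `d! < δs`, `0 < αs`) yields a
RUN frame at `k+1` (`u₁′ = e_h`, y′-rows ⟂ `resVertex (c (k+1))`, `pts′ ≠ ∅`, `d! < δs′`, `d·αs′ ≤ (n − 1)·d!`, `0 < αs′`) with
**`βs′ < βs`**.  LOSSY keeps are allowed (light letters translated away ride in the unit `ε`; the cleaning correction `R̃ ∈ (x_h^n)` goes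
through res-dim4-p-11 g5's XVI `exists_label_readaptation_of_step_pow`).  Composition: `direction_mem_resVertex_of_shade_eq` → R2
`exists_keep_rechoice` → XIV/VII/II → XV `betaS_step_lt_of_keep_pow` in the arrival frame with child-side inputs from (K-Φ1)-n
`mul_alphaS_le_of_isIsolated` at the isolated child (`α′ ≤ (n−1)/d`) and `α < 1` at the parent from `alphaS_lt_of_isIsolated`
(`r_h + d ≥ p`) → XVI → XI/XIII.  Rung-2 use: every ledger class whose KEEP-H steps keep a letter with `p − d ≤ r_h < p`.
§2 **`tail_heavy_keep_step`** — the CHAIN DRESS (one call per KEEP edge of a constant-shade `e_G = 2` tail; every tail fact from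
res-dim4-p-9 g5's `tail_factorisation` / `tail_step_factorisation` / `tail_weights_laws`), the KEEP twin of res-dim4-p-2 g6's
`tail_heavy_lose_step` (`…ResConeHeavyLoseTail` p710102).

[cite: CossartJannsenSaito2020, Lemma 11.5, Lemma 12.2 (5), Lemma 13.4 (3), Thm. 8.16] [cite: CossartPiltant2008, (16), Prop. 4.2]
[cite: Hauser2010, §§F–G]  bears_on: LADDER-RESOLUTION:D157-DOOR2 (res-dim4-pi · K2(p) · slice C heavy line · ∀ (p,d,n) KEEP step).
Supports stmt-ResolutionOfSingularities-16155 (helper).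
-/

set_option linter.dupNamespace false -- mandated namespace of this single-conjunct summit

noncomputable section

namespace Summit.ResolutionOfSingularities.ResolutionOfSingularities.Theorems.PIDim4

namespace ResCone

open MvPolynomial Finset IsLocalRing
open Literature.AlgebraicGeometry.Resolution
open Literature.AlgebraicGeometry.Resolution.CentreBlowup
open Literature.AlgebraicGeometry.Resolution.Hauser2010
open Literature.AlgebraicGeometry.Resolution.HauserPerlega2019
open Literature.AlgebraicGeometry.Resolution.WeightedOrder
open PointBlowup (direction additiveSubspace)

variable {K : Type} [Field K]

section Keep

variable [DecidableEq K]

/-- **THE HEAVY KEEP STEP, ∀ (p, d, n)** (factorisations, KEEP pattern and numerology as binders).  See the module docstring.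
[OURS] [cite: CossartJannsenSaito2020, Lemma 12.2 (5), Lemma 13.4 (3), Lemma 11.5] [cite: CossartPiltant2008, (16), Prop. 4.2] -/
theorem heavy_keep_step {p d n : ℕ} [CharP K p] {c : ℕ → State K} {j : ℕ → Fin 4} {b : ℕ → Fin 4 → K} {k : ℕ} {h : Fin 4}
    {G G₁ : MvPolynomial (Fin 4) K}
    -- numerology
    (hdp : d < p) (hn1 : 1 ≤ n) (hnd : n ≤ d) (hrn : (c k).r h + n = p)
    (hpo : p < (c k).r.degree + d) (ho2 : (c k).r.degree + d < 2 * p)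
    -- the factorisation package at `k` and `k + 1` and of the step
    (hF : (c k).F = monomial (c k).r 1 * G) (hd : ordZero G = d) (hdiv : ∀ e ∈ (c k).F.support, (c k).r ≤ e)
    (hbj : b k (j k) = 0)
    (hF' : (CentreBlowup.step p Finset.univ (j k) (b k) (c k)).F =
      monomial ((((c k).r.filter fun i => b k i = 0)).update (j k) ((c k).r.degree + d - p)) 1 * G₁)
    (hF₁ : (c (k + 1)).F = monomial (c (k + 1)).r 1 * G₁) (hd₁ : ordZero G₁ = d)
    (hiso : IsIsolated p (c k).F) (hiso₁ : IsIsolated p (c (k + 1)).F)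
    (hshade : (CentreBlowup.step p Finset.univ (j k) (b k) (c k)).shade = (c k).shade)
    (he : Module.finrank K (resVertex (c k)) = 2) (he₁ : Module.finrank K (resVertex (c (k + 1))) = 2)
    -- the KEEP pattern: the distinguished letter `h` is neither the chart letter nor translated
    (hjh : j k ≠ h) (hbh : b k h = 0) (hr'h : (c (k + 1)).r h = (c k).r h)
    -- the RUN frame at `k`
    {L : Fin (2 + 2) → Fin 4 → K} {M : Fin 4 → Fin (2 + 2) → K} (hM : ∀ t u, ∑ i, M t i * L i u = if t = u then 1 else 0)
    (hLu1 : L (u1 2) = Pi.single h 1)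
    (hy : ∀ i, i ≠ u1 2 → i ≠ u2 2 → ∀ w ∈ resVertex (c k), ∑ t, L i t * w t = 0)
    (hne : (pts (fun i => algebraMap (MvPolynomial (Fin 4) K) (OriginLocalization K 4) (∑ t, C (L i t) * X t))
      (Ideal.span {algebraMap (MvPolynomial (Fin 4) K) (OriginLocalization K 4) G}) d).Nonempty)
    (hδ : Nat.factorial d < deltaS (fun i => algebraMap (MvPolynomial (Fin 4) K) (OriginLocalization K 4) (∑ t, C (L i t) * X t))
      (Ideal.span {algebraMap (MvPolynomial (Fin 4) K) (OriginLocalization K 4) G}) d)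
    (hα0 : 0 < alphaS (fun i => algebraMap (MvPolynomial (Fin 4) K) (OriginLocalization K 4) (∑ t, C (L i t) * X t))
      (Ideal.span {algebraMap (MvPolynomial (Fin 4) K) (OriginLocalization K 4) G}) d) :
    ∃ (L' : Fin (2 + 2) → Fin 4 → K) (M' : Fin 4 → Fin (2 + 2) → K),
      ((∀ t u, ∑ i, M' t i * L' i u = if t = u then 1 else 0) ∧ L' (u1 2) = Pi.single h 1 ∧
        (∀ i, i ≠ u1 2 → i ≠ u2 2 → ∀ w ∈ resVertex (c (k + 1)), ∑ t, L' i t * w t = 0) ∧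
        (pts (fun i => algebraMap (MvPolynomial (Fin 4) K) (OriginLocalization K 4) (∑ t, C (L' i t) * X t))
          (Ideal.span {algebraMap (MvPolynomial (Fin 4) K) (OriginLocalization K 4) G₁}) d).Nonempty ∧
        Nat.factorial d < deltaS (fun i => algebraMap (MvPolynomial (Fin 4) K) (OriginLocalization K 4) (∑ t, C (L' i t) * X t))
          (Ideal.span {algebraMap (MvPolynomial (Fin 4) K) (OriginLocalization K 4) G₁}) d ∧
        d * alphaS (fun i => algebraMap (MvPolynomial (Fin 4) K) (OriginLocalization K 4) (∑ t, C (L' i t) * X t))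
          (Ideal.span {algebraMap (MvPolynomial (Fin 4) K) (OriginLocalization K 4) G₁}) d ≤ (n - 1) * Nat.factorial d) ∧
      0 < alphaS (fun i => algebraMap (MvPolynomial (Fin 4) K) (OriginLocalization K 4) (∑ t, C (L' i t) * X t))
          (Ideal.span {algebraMap (MvPolynomial (Fin 4) K) (OriginLocalization K 4) G₁}) d ∧
      betaS (fun i => algebraMap (MvPolynomial (Fin 4) K) (OriginLocalization K 4) (∑ t, C (L' i t) * X t))
          (Ideal.span {algebraMap (MvPolynomial (Fin 4) K) (OriginLocalization K 4) G₁}) d <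
        betaS (fun i => algebraMap (MvPolynomial (Fin 4) K) (OriginLocalization K 4) (∑ t, C (L i t) * X t))
          (Ideal.span {algebraMap (MvPolynomial (Fin 4) K) (OriginLocalization K 4) G}) d := by
  classical
  set alg := algebraMap (MvPolynomial (Fin 4) K) (OriginLocalization K 4) with halg
  have hp : p ≤ (c k).r.degree + d := hpo.le
  have hhm : h ≠ j k := fun h' => hjh h'.symm
  have hdG : (d : ℕ∞) ≤ ordZero G := hd.symm.le
  have hd' : (d : ℕ∞) ≤ ordZero G₁ := hd₁.symm.le
  have hJμ : Ideal.span {alg G} ≤ maximalIdeal (OriginLocalization K 4) ^ d :=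
    PhiLine.span_singleton_algebraMap_le_maximalIdeal_pow hdG
  -- (K-Φ1) at `c k` in the carried frame: `α < 1` (critical reading, `r_h + d ≥ p`)
  have hα1 : alphaS (fun i => alg (∑ t, C (L i t) * X t)) (Ideal.span {alg G}) d < Nat.factorial d :=
    (PhiLine.alphaS_lt_of_isIsolated (p := p) (d := d) hF hiso (h := h) (by omega)
      (fun i => alg (∑ t, C (L i t) * X t)) (span_range_frame_eq_maximalIdeal L M hM)
      (by simp only [hLu1, PhiLine.sum_C_single_mul_X]; rfl)).2
  -- (1) the step direction lies in `resVertex (c k)`, so the y-rows kill it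
  have ho : ordZero (c k).F = (((c k).r.degree + d : ℕ) : ℕ∞) := by
    rw [hF, PhiLine.ordZero_monomial_one_mul, hd, Nat.cast_add]
  have hdir : direction (j k) (b k) ∈ resVertex (c k) :=
    direction_mem_resVertex_of_shade_eq (j k) hbj ho hdiv hpo ho2 hshade
  have hrows : ∀ i, i ≠ u1 2 → i ≠ u2 2 → ∑ t, L i t * Function.update (b k) (j k) 1 t = 0 :=
    fun i hi1 hi2 => hy i hi1 hi2 _ hdir
  -- (2) R2: re-choose `u₂ := x_{j k}`
  obtain ⟨Lr, Mr, hMr, hLru1, hLru2, hLri, hnear, hner, hαr, hβr, hδr⟩ :=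
    PhiLine.exists_keep_rechoice L M hM hLu1 (dir := Function.update (b k) (j k) 1) (Function.update_self _ _ _)
      (by rw [Function.update_of_ne hhm, hbh]) hrows hJμ hne hα0
  have hyr : ∀ i, i ≠ u1 2 → i ≠ u2 2 → ∀ w ∈ resVertex (c k), ∑ t, Lr i t * w t = 0 := by
    intro i hi1 hi2 w hw'
    rw [hLri i hi2]
    exact hy i hi1 hi2 w hw'
  obtain ⟨hArBr, hBrAr⟩ := matrix_inverses_of_leftInverse hMr
  -- (3) the departure label `G = Ψ(y) + Q` (XIV), the weak transform in the arrival y-rows (VII), the child residual (II)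
  obtain ⟨Ψ, hΨ, hΨA, Q, hQ, hGΨ⟩ := PhiLine.exists_label_of_yRows_annihilate p (d := d) hdp hF hd hArBr hBrAr he
    (fun i hi1 hi2 w hw' => by simpa only [Matrix.of_apply] using hyr i hi1 hi2 w hw')
  obtain ⟨Q', hH₀⟩ := PhiLine.chartTransform_translate_label (j := j k) hbj (fun i : Fin 2 => Lr (Fin.castAdd 2 i))
    (fun i => hnear _ (castAdd_ne_u2 i)) hΨ hQ (G := G) (by simpa only [Matrix.of_apply] using hGΨ) hdG
  obtain ⟨R, hstep, hRmem⟩ := PhiLine.step_F_eq_monomial_mul_residual (p := p) (d := d) hF hdG hp (j k) hbj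
  rw [hF', monomial_one_mul_cancel_left_iff] at hstep
  -- the heavy exponent after the step is `r_k h = p − n`, prime to `p`; so `R̃ ∈ (x_h^n)`
  have hr'h₀ : ((((c k).r.filter fun i => b k i = 0)).update (j k) ((c k).r.degree + d - p)) h = (c k).r h := by
    rw [Finsupp.coe_update, Function.update_of_ne hhm, Finsupp.filter_apply_pos (fun i => b k i = 0) (c k).r hbh]
  have hRh : R ∈ Ideal.span {(X h : MvPolynomial (Fin 4) K) ^ n} := by
    have h1 := hRmem h (by
      rw [hr'h₀]; intro hdvd; have := Nat.le_of_dvd (by omega) hdvd; omega)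
    rwa [hr'h₀, show p - (c k).r h = n by omega] at h1
  have hε := PhiLine.constantCoeff_prod_ne_zero (b k) (fun i => (c k).r i)
  -- (4) the arrival frame; (K-Φ1)-n at the isolated CHILD read in it; XV child-side KEEP law
  set La : Fin (2 + 2) → Fin 4 → K :=
    Function.update (fun i => Function.update (Lr i) (j k) 0) (u2 2) (Pi.single (j k) 1) with hLa
  have hLau2 : La (u2 2) = Pi.single (j k) 1 := by rw [hLa, Function.update_self]
  have hLai : ∀ i, i ≠ u2 2 → La i = Function.update (Lr i) (j k) 0 := fun i hi => by
    rw [hLa, Function.update_of_ne hi]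
  have hLau1 : La (u1 2) = Pi.single h 1 := by
    rw [hLai _ u1_ne_u2, hLru1, PhiLine.update_single_of_ne hhm]
  have hMa := arrival_left_inverse hMr (piv := u2 2) hLru2 hLau2 hLai
  have hchild := PhiLine.mul_alphaS_le_of_isIsolated (p := p) (d := d) (n := n) hF₁ hiso₁ (h := h)
    (by rw [hr'h]; omega) hnd (fun i => alg (∑ t, C (La i t) * X t)) (span_range_frame_eq_maximalIdeal La _ hMa)
    (by simp only [hLau1, PhiLine.sum_C_single_mul_X]; rfl)
  have hα' : d * (alphaS (fun i => alg (∑ t, C (La i t) * X t)) (Ideal.span {alg G₁}) d + 1) ≤ n * Nat.factorial d :=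
    mul_succ_le_mul_factorial hchild.2 hn1
  obtain ⟨hnea, hαa, hβa⟩ := PhiLine.betaS_step_lt_of_keep_pow (p := p) (d := d) (n := n) hF hd hdp hp hhm
    hrn hn1 hnd hbj hbh Lr La Mr _ hMr hMa hLru1 hLru2 hnear hLau2 hLai hner
    (by rw [hδr]; exact hδ) (by rw [hαr]; exact hα1) hF' hd' hchild.1 hα'
  -- (5) XVI: the arrival frame is again a label after re-adapting its y-rows along `u₁` …
  obtain ⟨hAB, hBA⟩ := matrix_inverses_of_leftInverse hMa
  have hT := PhiLine.two_le_finrank_additiveSubspace_of_resVertex hF₁ hd₁ he₁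
  have hrowsA : (fun i : Fin 2 => ∑ t, C ((Matrix.of fun (i : Fin 4) (t : Fin 4) => La i t) (Fin.castAdd 2 i) t) * X t) =
      fun i : Fin 2 => ∑ t, C (Function.update (Lr (Fin.castAdd 2 i)) (j k) 0 t) * X t := by
    funext i
    simp only [Matrix.of_apply, hLai _ (castAdd_ne_u2 i)]
  have hH₀A : PointBlowup.translate (b k) (CentreBlowup.chartTransform d Finset.univ (j k) G) =
      aeval (fun i : Fin 2 => ∑ t, C ((Matrix.of fun (i : Fin 4) (t : Fin 4) => La i t) (Fin.castAdd 2 i) t) * X t) Ψ +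
        X (j k) * Q' := by
    rw [hrowsA]; exact hH₀
  have hAu2 : (Matrix.of fun (i : Fin 4) (t : Fin 4) => La i t) (u2 2) = Pi.single (j k) 1 := by
    funext t; rw [Matrix.of_apply, hLau2]
  have hAu1 : (Matrix.of fun (i : Fin 4) (t : Fin 4) => La i t) (u1 2) = Pi.single h 1 := by
    funext t; rw [Matrix.of_apply, hLau1]
  obtain ⟨lam, A', B', hA'B', hB'A', -, hA'u1, -, hne'', hδ'', hα'', hβ''⟩ :=
    PhiLine.exists_label_readaptation_of_step_pow p (d := d) hdp hAB hBA (u := u2 2)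
      (Finset.mem_insert_of_mem (Finset.mem_singleton_self _)) hAu2 hAu1 (e := n) hn1 hstep hd' hε hRh
      hH₀A hΨ hΨA hT hnea (by simp only [Matrix.of_apply]; rw [hαa, hαr]; exact hα0)
      (by simp only [Matrix.of_apply]; rw [hαa, hαr]; exact hα1)
  simp only [Matrix.of_apply] at hα'' hβ'' hne'' hδ''
  -- … and its y-rows lie in `(resVertex (c (k+1)))^⊥` (XIII)
  have hy'' := PhiLine.yRows_annihilate_of_label p (d := d) hdp hF₁ hd₁ hA'B' hB'A' he₁ hδ''
  refine ⟨A', B', ⟨fun t u => ?_, ?_, fun i hi1 hi2 w hw' => hy'' i hi1 hi2 w hw', hne'', hδ'', ?_⟩, ?_, ?_⟩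
  · have h1 := congrFun (congrFun hB'A' t) u
    rw [Matrix.mul_apply, Matrix.one_apply] at h1
    exact h1
  · rw [hA'u1, hAu1]
  · rw [hα'']; exact hchild.2
  · rw [hα'', hαa, hαr]; exact hα0
  · rw [hβ'', ← hβr]; exact hβa

end Keep

/-! ## 2. The chain dress: one call per KEEP edge of a constant-shade `e_G = 2` tail -/

section Tail

variable {p : ℕ} [hp : Fact p.Prime] [CharP K p] [DecidableEq K]

/-- **THE HEAVY KEEP STEP ON THE CHAIN, ∀ (p, d, n)** (chain dress of `heavy_keep_step`; the KEEP twin of res-dim4-p-2 g6's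
`tail_heavy_lose_step`).  Along a witnessed isolated above-floor `Step0 p` chain with `x^{r₀} ∣ F₀`, constant shade `d < p` and `e_G = 2`
from `k₀`, at any `k ≥ k₀` and boundary letter `h` with `r_k h + n = p`, `1 ≤ n ≤ d`, KEPT by the step (`j k ≠ h`, `b k h = 0`): a RUN
frame at `k` (`u₁ = e_h`, y-rows ⟂ `resVertex (c k)`, `pts ≠ ∅`, `d! < δs`, `0 < αs` for `(G_k)`, `G_k = F_k / x^{r_k}`) yields a RUN frame at
`k + 1` with the same `u₁ = e_h`, `d·αs′ ≤ (n − 1)·d!`, `0 < αs′` and **`βs′ < βs`**.  (The carried α-clause `d·αs ≤ (n−1)·d!` at `k` is not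
needed as an input: it is re-derived at the isolated child.)  Every tail fact from res-dim4-p-9 g5's `tail_factorisation` /
`tail_step_factorisation` / `tail_weights_laws`. [OURS] [cite: CossartJannsenSaito2020, Lemma 12.2 (5), Lemma 13.4 (3)] [cite: CossartPiltant2008, (16)] -/
theorem tail_heavy_keep_step {d n : ℕ} (hdp : d < p) (hn1 : 1 ≤ n) (hnd : n ≤ d) {c : ℕ → State K} {j : ℕ → Fin 4}
    {b : ℕ → Fin 4 → K} (hc : ∀ k, IsIsolated p (c k).F ∧ Step0 p (c k) (c (k + 1))) (hw : FreeTail.IsWitnessedChain p c j b)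
    (hr0 : ∀ e ∈ (c 0).F.support, (c 0).r ≤ e) (hfloor : ∀ k, ordZero (c k).F ≠ p) {k₀ : ℕ}
    (hshade : ∀ k, k₀ ≤ k → (c k).shade = ((d : ℕ) : ℕ∞))
    (he : ∀ k, k₀ ≤ k → Module.finrank K (resVertex (c k)) = 2)
    {k : ℕ} (hk : k₀ ≤ k) {h : Fin 4} (hrn : (c k).r h + n = p) (hjh : j k ≠ h) (hbh : b k h = 0)
    {L : Fin (2 + 2) → Fin 4 → K} {M : Fin 4 → Fin (2 + 2) → K} (hM : ∀ t u, ∑ i, M t i * L i u = if t = u then 1 else 0)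
    (hLu1 : L (u1 2) = Pi.single h 1)
    (hy : ∀ i, i ≠ u1 2 → i ≠ u2 2 → ∀ w ∈ resVertex (c k), ∑ t, L i t * w t = 0)
    (hne : (pts (fun i => algebraMap (MvPolynomial (Fin 4) K) (OriginLocalization K 4) (∑ t, C (L i t) * X t))
      (Ideal.span {algebraMap (MvPolynomial (Fin 4) K) (OriginLocalization K 4)
            ((c k).F.divMonomial (c k).r)}) d).Nonempty)
    (hδ : Nat.factorial d < deltaS (fun i => algebraMap (MvPolynomial (Fin 4) K) (OriginLocalization K 4) (∑ t, C (L i t) * X t))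
      (Ideal.span {algebraMap (MvPolynomial (Fin 4) K) (OriginLocalization K 4)
            ((c k).F.divMonomial (c k).r)}) d)
    (hα0 : 0 < alphaS (fun i => algebraMap (MvPolynomial (Fin 4) K) (OriginLocalization K 4) (∑ t, C (L i t) * X t))
      (Ideal.span {algebraMap (MvPolynomial (Fin 4) K) (OriginLocalization K 4)
            ((c k).F.divMonomial (c k).r)}) d) :
    ∃ (L' : Fin (2 + 2) → Fin 4 → K) (M' : Fin 4 → Fin (2 + 2) → K),
      ((∀ t u, ∑ i, M' t i * L' i u = if t = u then 1 else 0) ∧ L' (u1 2) = Pi.single h 1 ∧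
        (∀ i, i ≠ u1 2 → i ≠ u2 2 → ∀ w ∈ resVertex (c (k + 1)), ∑ t, L' i t * w t = 0) ∧
        (pts (fun i => algebraMap (MvPolynomial (Fin 4) K) (OriginLocalization K 4) (∑ t, C (L' i t) * X t))
          (Ideal.span {algebraMap (MvPolynomial (Fin 4) K) (OriginLocalization K 4)
            ((c (k + 1)).F.divMonomial (c (k + 1)).r)}) d).Nonempty ∧
        Nat.factorial d < deltaS (fun i => algebraMap (MvPolynomial (Fin 4) K) (OriginLocalization K 4) (∑ t, C (L' i t) * X t))
          (Ideal.span {algebraMap (MvPolynomial (Fin 4) K) (OriginLocalization K 4)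
            ((c (k + 1)).F.divMonomial (c (k + 1)).r)}) d ∧
        d * alphaS (fun i => algebraMap (MvPolynomial (Fin 4) K) (OriginLocalization K 4) (∑ t, C (L' i t) * X t))
          (Ideal.span {algebraMap (MvPolynomial (Fin 4) K) (OriginLocalization K 4)
            ((c (k + 1)).F.divMonomial (c (k + 1)).r)}) d ≤ (n - 1) * Nat.factorial d) ∧
      0 < alphaS (fun i => algebraMap (MvPolynomial (Fin 4) K) (OriginLocalization K 4) (∑ t, C (L' i t) * X t))
          (Ideal.span {algebraMap (MvPolynomial (Fin 4) K) (OriginLocalization K 4)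
            ((c (k + 1)).F.divMonomial (c (k + 1)).r)}) d ∧
      betaS (fun i => algebraMap (MvPolynomial (Fin 4) K) (OriginLocalization K 4) (∑ t, C (L' i t) * X t))
          (Ideal.span {algebraMap (MvPolynomial (Fin 4) K) (OriginLocalization K 4)
            ((c (k + 1)).F.divMonomial (c (k + 1)).r)}) d <
        betaS (fun i => algebraMap (MvPolynomial (Fin 4) K) (OriginLocalization K 4) (∑ t, C (L i t) * X t))
          (Ideal.span {algebraMap (MvPolynomial (Fin 4) K) (OriginLocalization K 4)
            ((c k).F.divMonomial (c k).r)}) d := by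
  have hk1 : k₀ ≤ k + 1 := by omega
  obtain ⟨hF, hd, hpo, ho2, hdiv⟩ := tail_factorisation hc hr0 hfloor hshade hk
  obtain ⟨hF', -⟩ := tail_step_factorisation hc hw hr0 hfloor hshade hk
  obtain ⟨hF₁, hd₁, -, -, -⟩ := tail_factorisation hc hr0 hfloor hshade hk1
  obtain ⟨-, hlaw, hbj, -, -⟩ := tail_weights_laws hc hw hr0 hfloor hshade
  have hck1 : c (k + 1) = CentreBlowup.step p Finset.univ (j k) (b k) (c k) := (hw k).2.2.2.2
  have hshade_eq : (CentreBlowup.step p Finset.univ (j k) (b k) (c k)).shade = (c k).shade := by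
    rw [← hck1, hshade (k + 1) hk1, hshade k hk]
  have hr'h : (c (k + 1)).r h = (c k).r h := by
    rw [hlaw k hk, Finsupp.coe_update, Function.update_of_ne (Ne.symm hjh),
      Finsupp.filter_apply_pos (fun i => b k i = 0) (c k).r hbh]
  exact heavy_keep_step hdp hn1 hnd hrn hpo ho2 hF hd hdiv (hbj k) hF' hF₁ hd₁ (hc k).1 (hc (k + 1)).1 hshade_eq
    (he k hk) (he (k + 1) hk1) hjh hbh hr'h hM hLu1 hy hne hδ hα0

end Tail

end ResCone

end Summit.ResolutionOfSingularities.ResolutionOfSingularities.Theorems.PIDim4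

end
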